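import Mathlib.Algebra.Module.ZLattice.Basic
import Mathlib.Analysis.InnerProductSpace.PiL2
import Mathlib.LinearAlgebra.Basis.SMul
import Mathlib.LinearAlgebra.Basis.Submodule
import HarnessLib

/-!
# The lattice `q⁻¹ℤ^ι ⊆ ℝ^ι` with its standard basis and integer coordinates

Topic `Algebra/EuclideanLattices` (family `pqc`). The concrete lattice of BLPRS 2013 (`Λ = q⁻¹ℤⁿ`, the
representatives of `𝕋_q = q⁻¹ℤ/ℤ`, §2.3; the noise lattice of `extLWE`, Def. 4.4; `q⁻¹ℤᵐ` in Lemma 4.7;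
`q⁻¹ℤⁿ` in Lemmas 3.5, 4.9) as a `Submodule ℤ (EuclideanSpace ℝ ι)` carrying the instances the tree's
lattice-Gaussian toolkit needs (`DiscreteTopology`, `IsZLattice`), with the `ℤ`-basis `i ↦ q⁻¹eᵢ` and the
integer-coordinate map `λ ↦ qλ ∈ ℤ^ι` — the instantiation data that `ModulusSwitchCore.lean`,
`LWEBinaryNoiseCloseness.lean` ("the instantiation of `L` … left to the assembly") and the packaging of
Lemma 4.7 consume. Proved (no named fact); the `def`s are the basis, the lattice and the coordinate maps.

## Results (`q ≥ 1`, finite index type `ι`)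

* `scaledStdBasis q : Basis ι ℝ (EuclideanSpace ℝ ι)` (`= q⁻¹ •` standard basis), `scaledStdBasis_apply`,
  `scaledStdBasis_repr` (`= q · xᵢ`);
* `scaledIntLattice q = span_ℤ(scaledStdBasis q) = q⁻¹ℤ^ι` with `DiscreteTopology`/`IsZLattice` instances,
  `mem_scaledIntLattice_iff` (`x ∈ q⁻¹ℤ^ι ↔ ∀ i, q xᵢ ∈ ℤ`), `toLp_intCast_div_mem` (`k/q ∈ q⁻¹ℤ^ι`),
  `toLp_intCast_mem` (`ℤ^ι ⊆ q⁻¹ℤ^ι`);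
* `latticeBasisZ q : Basis ι ℤ (scaledIntLattice q)`, `intCoords` (`λ ↦ qλ ∈ ℤ^ι`),
  `cast_intCoords` (`(qλ)ᵢ = q · λᵢ`), `intCoords_add`, `ofIntCoords` and the two inverse laws,
  `coe_ofIntCoords_apply` (`(ofIntCoords k)ᵢ = kᵢ/q`);
* `inner_intCastLp_eq_intCoords_dotProduct_div` — the pairing hypothesis of `LWEBinaryNoiseCloseness`:
  `⟪z̄, λ⟫ = ⟨qλ, z⟩/q` for an integer vector `z` read in `ℝ^ι`.

## References

* Z. Brakerski, A. Langlois, C. Peikert, O. Regev, D. Stehlé, *Classical hardness of learning with errors*,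
  STOC 2013; arXiv:1306.0281, §2.3 (`𝕋_q`, representatives `q⁻¹ℤ`), Def. 4.4, Lemmas 3.5, 4.7, 4.9.
-/

noncomputable section

open Module Submodule Matrix
open scoped RealInnerProductSpace

namespace Literature.Algebra.EuclideanLattices

variable {ι : Type} [Fintype ι] (q : ℕ) [NeZero q]

/-- `q ≠ 0` in `ℝ`. [folklore] -/
theorem natCast_ne_zero_real : (q : ℝ) ≠ 0 := by exact_mod_cast NeZero.ne q

/-- **The basis `i ↦ q⁻¹ eᵢ` of `ℝ^ι`.** [cite: BrakerskiEtAl2013, §2.3] -/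
def scaledStdBasis : Basis ι ℝ (EuclideanSpace ℝ ι) :=
  (EuclideanSpace.basisFun ι ℝ).toBasis.unitsSMul fun _ => Units.mk0 ((q : ℝ)⁻¹) (inv_ne_zero (natCast_ne_zero_real q))

/-- `scaledStdBasis q i = q⁻¹ • eᵢ`. [folklore] -/
theorem scaledStdBasis_apply [DecidableEq ι] (i : ι) : scaledStdBasis q i = (q : ℝ)⁻¹ • EuclideanSpace.single i (1 : ℝ) := by
  rw [scaledStdBasis, Basis.unitsSMul_apply, ← EuclideanSpace.basisFun_apply]
  rfl

/-- Coordinates in the scaled basis: `(scaledStdBasis q).repr x i = q · xᵢ`. [folklore] -/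
theorem scaledStdBasis_repr (x : EuclideanSpace ℝ ι) (i : ι) : (scaledStdBasis q).repr x i = q * x i := by
  rw [scaledStdBasis, Basis.repr_unitsSMul]
  simp [Units.smul_def]

/-- **The lattice `q⁻¹ℤ^ι`**: the `ℤ`-span of the scaled basis. [cite: BrakerskiEtAl2013, §2.3] -/
def scaledIntLattice : Submodule ℤ (EuclideanSpace ℝ ι) := span ℤ (Set.range (scaledStdBasis (ι := ι) q))

/-- `q⁻¹ℤ^ι` is discrete (the `ℤ`-span of a real basis). [folklore] -/
instance : DiscreteTopology (scaledIntLattice (ι := ι) q) := by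
  unfold scaledIntLattice; infer_instance

/-- `q⁻¹ℤ^ι` is a full lattice (the `ℤ`-span of a real basis spans `ℝ^ι`). [folklore] -/
instance : IsZLattice ℝ (scaledIntLattice (ι := ι) q) := by
  unfold scaledIntLattice; infer_instance

/-- **Membership**: `x ∈ q⁻¹ℤ^ι ↔ ∀ i, q xᵢ ∈ ℤ`. [cite: BrakerskiEtAl2013, §2.3] -/
theorem mem_scaledIntLattice_iff (x : EuclideanSpace ℝ ι) :
    x ∈ scaledIntLattice q ↔ ∀ i, ∃ k : ℤ, (k : ℝ) = q * x i := by
  rw [scaledIntLattice, Basis.mem_span_iff_repr_mem]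
  refine forall_congr' fun i => ?_
  rw [scaledStdBasis_repr]
  constructor
  · rintro ⟨k, hk⟩; exact ⟨k, hk⟩
  · rintro ⟨k, hk⟩; exact ⟨k, hk⟩

/-- `k/q ∈ q⁻¹ℤ^ι` for every integer vector `k`. [cite: BrakerskiEtAl2013, §2.3] -/
theorem toLp_intCast_div_mem (k : ι → ℤ) :
    WithLp.toLp 2 (fun i => (k i : ℝ) / q) ∈ scaledIntLattice (ι := ι) q := by
  rw [mem_scaledIntLattice_iff]
  intro i
  refine ⟨k i, ?_⟩
  show (k i : ℝ) = q * ((k i : ℝ) / q)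
  rw [mul_div_cancel₀ _ (natCast_ne_zero_real q)]

/-- `ℤ^ι ⊆ q⁻¹ℤ^ι`. [cite: BrakerskiEtAl2013, §2.3] -/
theorem toLp_intCast_mem (k : ι → ℤ) : WithLp.toLp 2 (fun i => (k i : ℝ)) ∈ scaledIntLattice (ι := ι) q := by
  rw [mem_scaledIntLattice_iff]
  intro i
  exact ⟨q * k i, by push_cast; rfl⟩

/-- **The `ℤ`-basis `i ↦ q⁻¹eᵢ` of `q⁻¹ℤ^ι`.** [cite: BrakerskiEtAl2013, §2.3] -/
def latticeBasisZ : Basis ι ℤ (scaledIntLattice (ι := ι) q) :=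
  (scaledStdBasis q).restrictScalars ℤ

/-- **Integer coordinates** `λ ↦ qλ ∈ ℤ^ι` of a lattice vector. [cite: BrakerskiEtAl2013, §2.3] -/
def intCoords (lam : scaledIntLattice (ι := ι) q) : ι → ℤ := fun i => (latticeBasisZ q).repr lam i

/-- `(qλ)ᵢ = q · λᵢ` in `ℝ`. [folklore] -/
theorem cast_intCoords (lam : scaledIntLattice (ι := ι) q) (i : ι) :
    ((intCoords q lam i : ℤ) : ℝ) = q * (lam : EuclideanSpace ℝ ι) i := by
  rw [intCoords, latticeBasisZ, ← scaledStdBasis_repr q (lam : EuclideanSpace ℝ ι) i,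
    ← Basis.restrictScalars_repr_apply ℤ (scaledStdBasis q) lam i]
  rfl

/-- The lattice vector is recovered from its integer coordinates: `λᵢ = (qλ)ᵢ/q`. [folklore] -/
theorem coe_apply_eq_intCoords_div (lam : scaledIntLattice (ι := ι) q) (i : ι) :
    (lam : EuclideanSpace ℝ ι) i = (intCoords q lam i : ℝ) / q := by
  rw [cast_intCoords, mul_div_cancel_left₀ _ (natCast_ne_zero_real q)]

/-- Integer coordinates are additive. [folklore] -/
theorem intCoords_add (lam lam' : scaledIntLattice (ι := ι) q) :
    intCoords q (lam + lam') = intCoords q lam + intCoords q lam' := by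
  funext i
  simp [intCoords]

/-- Integer coordinates of a difference. [folklore] -/
theorem intCoords_sub (lam lam' : scaledIntLattice (ι := ι) q) :
    intCoords q (lam - lam') = intCoords q lam - intCoords q lam' := by
  funext i
  simp [intCoords]

/-- Integer coordinates determine the lattice vector. [folklore] -/
theorem intCoords_injective : Function.Injective (intCoords (ι := ι) q) := by
  intro lam lam' h
  have : (latticeBasisZ q).repr lam = (latticeBasisZ q).repr lam' := by
    ext i
    exact congrFun h i
  exact (latticeBasisZ q).repr.injective this

/-- **The lattice vector with prescribed integer coordinates** `k ↦ k/q`. [cite: BrakerskiEtAl2013, §2.3] -/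
def ofIntCoords (k : ι → ℤ) : scaledIntLattice (ι := ι) q :=
  ⟨WithLp.toLp 2 (fun i => (k i : ℝ) / q), toLp_intCast_div_mem q k⟩

/-- `(ofIntCoords k)ᵢ = kᵢ/q`. [folklore] -/
theorem coe_ofIntCoords_apply (k : ι → ℤ) (i : ι) :
    ((ofIntCoords q k : scaledIntLattice q) : EuclideanSpace ℝ ι) i = (k i : ℝ) / q := rfl

/-- `intCoords (ofIntCoords k) = k`. [folklore] -/
theorem intCoords_ofIntCoords (k : ι → ℤ) : intCoords q (ofIntCoords q k) = k := by
  funext i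
  have h := cast_intCoords q (ofIntCoords q k) i
  rw [coe_ofIntCoords_apply, mul_div_cancel₀ _ (natCast_ne_zero_real q)] at h
  exact_mod_cast h

/-- `ofIntCoords (intCoords λ) = λ`. [folklore] -/
theorem ofIntCoords_intCoords (lam : scaledIntLattice (ι := ι) q) : ofIntCoords q (intCoords q lam) = lam :=
  intCoords_injective q (intCoords_ofIntCoords q _)

/-- Integer vectors have integer coordinates `q · k`. [folklore] -/
theorem intCoords_toLp_intCast (k : ι → ℤ) :
    intCoords q ⟨WithLp.toLp 2 (fun i => (k i : ℝ)), toLp_intCast_mem q k⟩ = fun i => (q : ℤ) * k i := by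
  funext i
  have h := cast_intCoords q ⟨WithLp.toLp 2 (fun i => (k i : ℝ)), toLp_intCast_mem q k⟩ i
  rw [show ((⟨WithLp.toLp 2 (fun i => (k i : ℝ)), toLp_intCast_mem q k⟩ : scaledIntLattice q) :
      EuclideanSpace ℝ ι) i = (k i : ℝ) from rfl] at h
  exact_mod_cast h

/-- **The pairing of `LWEBinaryNoiseCloseness`**: for an integer vector `z` read in `ℝ^ι` as `z̄` and a
lattice vector `λ ∈ q⁻¹ℤ^ι`, `⟪z̄, λ⟫ = ⟨qλ, z⟩/q`. [cite: BrakerskiEtAl2013, Lemma 4.9 (proof, "-Nᵀz")] -/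
theorem inner_intCastLp_eq_intCoords_dotProduct_div (z : ι → ℤ) (lam : scaledIntLattice (ι := ι) q) :
    ⟪WithLp.toLp 2 (fun i => (z i : ℝ)), (lam : EuclideanSpace ℝ ι)⟫ =
      (((intCoords q lam ⬝ᵥ z : ℤ)) : ℝ) / q := by
  rw [EuclideanSpace.inner_eq_star_dotProduct, star_trivial, dotProduct, dotProduct, Int.cast_sum,
    Finset.sum_div]
  refine Finset.sum_congr rfl fun i _ => ?_
  rw [WithLp.ofLp_toLp, Int.cast_mul, cast_intCoords]
  rw [mul_comm ((q : ℝ)) _, mul_assoc, mul_comm ((q : ℝ)), ← mul_assoc,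
    mul_div_cancel_right₀ _ (natCast_ne_zero_real q), mul_comm]

end Literature.Algebra.EuclideanLattices

end
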